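import Summits.AtomisticToContinuum.Crystallization.Theorems.ChartedPlanarOrderStraddleLipschitz
import Summits.AtomisticToContinuum.Crystallization.Theorems.ChartedPlanarOrderPairModulusB

/-!
# 7c′ᴸ HOLDS — slot 7c′ of lens-4's UniformCut cone reduces to its CONVEXITY half 7c′ᶜ alone (decomp-a2c lens-3 g24, task (w))

Two-line corollaries of (u) `…StraddleLipschitz` (7c′ᴸ ⟸ 7c′ᴾ `PairModulusW'`) and (v) `…PairModulus`
(`pairModulus_of_cleanP_stacked`: 7c′ᴾ holds for every clean separated stacked layered configuration with `‖a‖, ‖b‖ ≤ 17/16`, on every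
`ρ`-tube with `ρ < 19/50`):

* `pairModulusW_of_le`, `pairModulusW'_of_le` — 7c′ᴾ `PairModulusW Λ ρ`, `PairModulusW' Λ ρ` for all `Λ ≤ 17/16`, `ρ < 19/50`;
* ★★ `tubeLipschitzW_of_le`, `tubeLipschitzW'_of_le` — 7c′ᴸ `TubeLipschitzW Λ ρ`, `TubeLipschitzW' Λ ρ` (same range) — the ANALYTIC (ℓ¹,
  first-moment) half of the tube-convex data is a THEOREM;
* ★★★ `tubeConvexW'_of_convexityW'`, `tubeConvexW_of_convexityW` — `TubeConvexityW' Λ ρ → TubeConvexW' Λ ρ` (and the IsNash-only twin): slot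
  7c′ OF RECORD `TubeConvexW' (17/16) (1/40)` ⟸ 7c′ᶜ `TubeConvexityW' (17/16) (1/40)` (`tubeConvexW'_record_of_convexity`), the pure GLOBAL
  ℓ²-MONOTONICITY statement [ANALYTIC · float-certified by the census, TAG 161b: `λ_conv(1/40) ≈ 2.2`, margin `≈ 1.8`];
* ★ `rdef_of_grossU_shape_gluing_pinning_convexityW'` — lens-4's RDEF cone of record with slot 7 fed by 7c′ᶜ only (for `Λ₁ ≤ 17/16`, `ρ₀ < 19/50`;
  of record at `(2, 17/16; 1/40, 3/16)`).

No new definitions; no instances, no notation; sorry-free.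
-/

namespace Summit.AtomisticToContinuum.Crystallization.Theorems.ChartedPlanarOrderTubeLipschitz

open Summit.AtomisticToContinuum.Crystallization.Theses.OverbindingBudget (RobustDefectLimitWindows)
open Summit.AtomisticToContinuum.Crystallization.Theses.PricedLinkCensus (ChargedEnergyGap)
open Summit.AtomisticToContinuum.Crystallization.Theorems.OverbindingBudgetGradedBareness (CleanlessExcessT)
open Summit.AtomisticToContinuum.Crystallization.Theorems.OverbindingBudgetCoherentCut (CoherentResidual)
open Summit.AtomisticToContinuum.Crystallization.Theorems.OverbindingBudgetUniformCutStatements (GrossCleanBallsU)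
open Summit.AtomisticToContinuum.Crystallization.Theorems.OverbindingBudgetElasticSplitScale (CompressedVirialLaw)
open Summit.AtomisticToContinuum.Crystallization.Theorems.OverbindingBudgetScaleWidening (DoorPeriodicW)
open Summit.AtomisticToContinuum.Crystallization.Theorems.OverbindingBudgetTwoShellShape (TwoShellShape BarlowGluingW)
open Summit.AtomisticToContinuum.Crystallization.Theorems.OverbindingBudgetStackedRigidityW (StackedReductionW GapStressVanishesW
  BasalReferenceW)
open Summit.AtomisticToContinuum.Crystallization.Theorems.OverbindingBudgetStackedRigidityRef (RegistryPinningW)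
open Summit.AtomisticToContinuum.Crystallization.Theorems.ChartedPlanarOrderTubeConvex (TubeConvexW' TubeConvexW
  rdef_of_grossU_shape_gluing_pinning_convexW')
open Summit.AtomisticToContinuum.Crystallization.Theorems.ChartedPlanarOrderTubeConvexSplit (TubeLipschitzW' TubeLipschitzW TubeConvexityW'
  TubeConvexityW tubeConvexW'_of_split tubeConvexW_of_split)
open Summit.AtomisticToContinuum.Crystallization.Theorems.ChartedPlanarOrderStraddleLipschitz (PairModulusW' PairModulusW pairModulusW'_of_W
  tubeLipschitzW'_of_pairModulusW' tubeLipschitzW_of_pairModulusW)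
open Summit.AtomisticToContinuum.Crystallization.Theorems.ChartedPlanarOrderPairModulus (pairModulus_of_cleanP_stacked)

/-- ★ 7c′ᴾ HOLDS: `PairModulusW Λ ρ` for `Λ ≤ 17/16`, `ρ < 19/50` (`IsCleanW = IsCleanP (103/100)`, `103/100 ≤ 8/7`). -/
theorem pairModulusW_of_le {Λ ρ : ℝ} (hΛ : Λ ≤ 17 / 16) (hρ : ρ < 19 / 50) : PairModulusW Λ ρ :=
  fun _ hδ _ _ _ ha hb hs hc _ hst =>
    pairModulus_of_cleanP_stacked (aHi := 103 / 100) (by norm_num) hρ hδ hs hc hst (ha.trans hΛ) (hb.trans hΛ)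

/-- `PairModulusW' Λ ρ` for `Λ ≤ 17/16`, `ρ < 19/50` (via `pairModulusW_of_le` and `pairModulusW'_of_W`). [folklore] -/
theorem pairModulusW'_of_le {Λ ρ : ℝ} (hΛ : Λ ≤ 17 / 16) (hρ : ρ < 19 / 50) : PairModulusW' Λ ρ :=
  pairModulusW'_of_W (pairModulusW_of_le hΛ hρ)

/-- ★★ 7c′ᴸ HOLDS (IsNash-only binder list): `TubeLipschitzW Λ ρ` for `Λ ≤ 17/16`, `ρ < 19/50`. -/
theorem tubeLipschitzW_of_le {Λ ρ : ℝ} (hΛ : Λ ≤ 17 / 16) (hρ : ρ < 19 / 50) : TubeLipschitzW Λ ρ :=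
  tubeLipschitzW_of_pairModulusW (pairModulusW_of_le hΛ hρ)

/-- ★★ 7c′ᴸ HOLDS (W′ binder list): `TubeLipschitzW' Λ ρ` for `Λ ≤ 17/16`, `ρ < 19/50`. -/
theorem tubeLipschitzW'_of_le {Λ ρ : ℝ} (hΛ : Λ ≤ 17 / 16) (hρ : ρ < 19 / 50) : TubeLipschitzW' Λ ρ :=
  tubeLipschitzW'_of_pairModulusW' (pairModulusW'_of_le hΛ hρ)

/-- ★★★ SLOT 7c′ ⟸ ITS CONVEXITY HALF: `TubeConvexityW' Λ ρ → TubeConvexW' Λ ρ` for `Λ ≤ 17/16`, `ρ < 19/50`. -/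
theorem tubeConvexW'_of_convexityW' {Λ ρ : ℝ} (hΛ : Λ ≤ 17 / 16) (hρ : ρ < 19 / 50) (hC : TubeConvexityW' Λ ρ) : TubeConvexW' Λ ρ :=
  tubeConvexW'_of_split (tubeLipschitzW'_of_le hΛ hρ) hC

/-- the IsNash-only twin: `TubeConvexityW Λ ρ → TubeConvexW Λ ρ`. -/
theorem tubeConvexW_of_convexityW {Λ ρ : ℝ} (hΛ : Λ ≤ 17 / 16) (hρ : ρ < 19 / 50) (hC : TubeConvexityW Λ ρ) : TubeConvexW Λ ρ :=
  tubeConvexW_of_split (tubeLipschitzW_of_le hΛ hρ) hC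

/-- ★★★ OF RECORD: `TubeConvexityW' (17/16) (1/40) → TubeConvexW' (17/16) (1/40)`. -/
theorem tubeConvexW'_record_of_convexity (hC : TubeConvexityW' (17 / 16) (1 / 40)) : TubeConvexW' (17 / 16) (1 / 40) :=
  tubeConvexW'_of_convexityW' le_rfl (by norm_num) hC

/-- ★ **RDEF cone `…_pinning_convexityW'`**: lens-4's cone of record `…_pinning_convexW'` with slot 7 fed by the CONVEXITY HALF 7c′ᶜ
`TubeConvexityW' Λ₁ ρ₀` only (`Λ₁ ≤ 17/16`, `ρ₀ < 19/50`; of record at `(Λ, Λ₁; ρ₀, ρ₁) = (2, 17/16; 1/40, 3/16)`). -/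
theorem rdef_of_grossU_shape_gluing_pinning_convexityW' (Λ Λ₁ ρ₀ ρ₁ : ℝ) (hΛ₁ : Λ₁ ≤ 17 / 16) (hρ₀ : ρ₀ < 19 / 50)
    (hG : GrossCleanBallsU (1 / 250) 10) (hCEG : ChargedEnergyGap) (hC : CompressedVirialLaw (1 / 250) 10)
    (hS : TwoShellShape (1 / 100) (3 / 50) (1 / 450)) (hB₂ : BarlowGluingW) (hD : DoorPeriodicW Λ) (hSR : StackedReductionW Λ Λ₁)
    (hV : GapStressVanishesW Λ₁) (hP : RegistryPinningW Λ₁ ρ₀ ρ₁) (hT : TubeConvexityW' Λ₁ ρ₀) (hRef : BasalReferenceW Λ₁ ρ₁)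
    (hCE : CleanlessExcessT) (hRes : CoherentResidual 10) : RobustDefectLimitWindows :=
  rdef_of_grossU_shape_gluing_pinning_convexW' Λ Λ₁ ρ₀ ρ₁ hG hCEG hC hS hB₂ hD hSR hV hP (tubeConvexW'_of_convexityW' hΛ₁ hρ₀ hT) hRef hCE
    hRes

/-- the cone OF RECORD: `(Λ, Λ₁; ρ₀, ρ₁) = (2, 17/16; 1/40, 3/16)`, slot 7 = `TubeConvexityW' (17/16) (1/40)`. -/
theorem rdef_of_grossU_shape_gluing_pinning_convexityW'_record (hG : GrossCleanBallsU (1 / 250) 10) (hCEG : ChargedEnergyGap)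
    (hC : CompressedVirialLaw (1 / 250) 10) (hS : TwoShellShape (1 / 100) (3 / 50) (1 / 450)) (hB₂ : BarlowGluingW) (hD : DoorPeriodicW 2)
    (hSR : StackedReductionW 2 (17 / 16)) (hV : GapStressVanishesW (17 / 16)) (hP : RegistryPinningW (17 / 16) (1 / 40) (3 / 16))
    (hT : TubeConvexityW' (17 / 16) (1 / 40)) (hRef : BasalReferenceW (17 / 16) (3 / 16)) (hCE : CleanlessExcessT)
    (hRes : CoherentResidual 10) : RobustDefectLimitWindows :=
  rdef_of_grossU_shape_gluing_pinning_convexityW' 2 (17 / 16) (1 / 40) (3 / 16) le_rfl (by norm_num) hG hCEG hC hS hB₂ hD hSR hV hP hT hRef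
    hCE hRes

end Summit.AtomisticToContinuum.Crystallization.Theorems.ChartedPlanarOrderTubeLipschitz
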